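import Summits.BirchSwinnertonDyer.BirchSwinnertonDyer.Theorems.PrintCFramBottomClassIndexLawFiveLeEisensteinPairUnique
import Literature.NumberTheory.QuadraticFields.KroneckerSplitting
import Literature.NumberTheory.EllipticCurves.HeegnerPointsImaginaryQuadraticProofs
import Literature.NumberTheory.EllipticCurves.KrizLi2019.EisensteinHeegnerLog
import HarnessLib

/-!
# Crux `PrintCFram.BottomClassIndexLawFiveLe` (stmt-BirchSwinnertonDyer-20372), line `eisenstein-resource-bdp-line` (registry v10):
# THE BERNOULLI UNITS OF THE KRIZ–LI DATUM, part K — THE KRONECKER CHARACTER OF AN IMAGINARY QUADRATIC FIELD IS ODD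
# (`IsKroneckerCharacterOf K ε_K ⟹ ε_K(−1) = −1`), via the decomposition law and quadratic reciprocity
# (cell `bsd-print-cfram`, width seat `bsd-line-cfram-p1-w3` g4; THEOREMS ONLY, `--supports` 20372; BSD is not proved by any of this)

HONEST FRAMING. Nothing here is a statement about BSD; no stub of the skeleton is closed. Stub H binds Kriz–Li's `ε_K` only
through `KrizLi2019.IsKroneckerCharacterOf K ε_K` (primitive; `ε_K(ℓ) = +1 / −1` according as the prime `ℓ ∤ d_K` splits / is
inert in `K`). The six-term table needs the PARITIES of the four lifts `ψ₀, ψ₀ε_K, ψ₀⁻¹ω, ψ₀⁻¹ωε_K` (Mazur–Wiles' Thm. 2 is for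
ODD characters; reflection pairs even with odd), i.e. `ε_K(−1) = −1` for the imaginary quadratic `K`. Proof: choose a prime
`ℓ ≡ −1 (mod 4|d_K|)` (Dirichlet, tree `EisensteinPair.exists_prime_eq_not_dvd`); then `ε_K(−1) = ε_K(ℓ)`, and `ℓ` is INERT:
by the decomposition law (tree `Quadratic.ncard_primesOver_eq_two_iff_jacobiSym`) `ℓ` splits iff `J(d_K | ℓ) = 1`, while
`J(d_K | ℓ) = J(d_K | 4|d_K| − 1) = J(−D | 4D − 1) = χ₄(4D−1)·J(D | 4D−1) = −1` (`D = |d_K|`; `J(D | 4D − 1) = 1` by quadratic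
reciprocity after splitting off the `2`-part of `D`).

* `jacobiSym_natCast_four_mul_sub_one` (`J(D | 4D − 1) = 1`), `jacobiSym_neg_natCast_four_mul_sub_one` (`J(−D | 4D − 1) = −1`);
* **`odd_of_isKroneckerCharacterOf`**: `IsImaginaryQuadratic K → IsKroneckerCharacterOf K ε_K → ε_K.Odd`.

beyond-print theorem: NO. References: [Cox2013] §1.C Lemma 1.14 and (1.18); [IrelandRosen1990] Prop. 5.2.2 and §13.1;
[KrizLi2019] §2 (p. 12, `ε_K : (ℤ/d_K)ˣ → μ₂`).
-/

set_option autoImplicit false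
set_option linter.dupNamespace false

noncomputable section

open scoped Classical NumberTheorySymbols
open DirichletCharacter Literature.NumberTheory.EllipticCurves.KrizLi2019 Literature.NumberTheory.EllipticCurves

namespace Summit.BirchSwinnertonDyer.BirchSwinnertonDyer.Theorems.PrintCFram.BernoulliUnits

open Summit.BirchSwinnertonDyer.BirchSwinnertonDyer.Theorems.PrintCFram

/-- **`J(D | 4D − 1) = 1` for every `D ≥ 1`.** Write `D = 2^e·D'` with `D'` odd and `b = 4D − 1`: `J(2 | b)^e = 1` (`b ≡ 7 (mod 8)`
when `e ≥ 1`), and `J(D' | b) = (−1)^{(D'−1)/2·(b−1)/2}·J(b | D') = (−1)^{(D'−1)/2}·J(−1 | D') = (−1)^{(D'−1)/2}·(−1)^{(D'−1)/2} = 1`.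
[cite: IrelandRosen1990, Prop. 5.2.2 (reciprocity for the Jacobi symbol)] -/
theorem jacobiSym_natCast_four_mul_sub_one {D : ℕ} (hD : D ≠ 0) : J((D : ℤ) | 4 * D - 1) = 1 := by
  obtain ⟨e, D', hD'odd, hDe⟩ := Nat.exists_eq_two_pow_mul_odd hD
  have hD'0 : D' ≠ 0 := by rintro rfl; exact hD (by rw [hDe, mul_zero])
  have hb_odd : _root_.Odd (4 * D - 1) := ⟨2 * D - 1, by omega⟩
  -- split off the `2`-part
  have hsplit : J((D : ℤ) | 4 * D - 1) = J(2 | 4 * D - 1) ^ e * J((D' : ℤ) | 4 * D - 1) := by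
    have hDz : (D : ℤ) = (2 : ℤ) ^ e * (D' : ℤ) := by rw [hDe]; push_cast; ring
    rw [hDz, jacobiSym.mul_left, jacobiSym.pow_left]
  have h2 : J(2 | 4 * D - 1) ^ e = 1 := by
    rcases Nat.eq_zero_or_pos e with he | he
    · rw [he, pow_zero]
    · have h8 : (4 * D - 1) % 8 = 7 := by
        obtain ⟨e', rfl⟩ := Nat.exists_eq_succ_of_ne_zero he.ne'
        have : 4 * D = 8 * (2 ^ e' * D') := by rw [hDe, pow_succ]; ring
        omega
      rw [jacobiSym.at_two hb_odd, ZMod.χ₈_nat_eq_if_mod_eight, if_neg (by omega : ¬ (4 * D - 1) % 2 = 0),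
        if_pos (Or.inr h8), one_pow]
  have hD' : J((D' : ℤ) | 4 * D - 1) = 1 := by
    rw [jacobiSym.quadratic_reciprocity hD'odd hb_odd]
    have hbD' : J(((4 * D - 1 : ℕ) : ℤ) | D') = J(-1 | D') := by
      apply jacobiSym.mod_left'
      have e1 : ((4 * D - 1 : ℕ) : ℤ) = -1 + ((4 * 2 ^ e : ℕ) : ℤ) * (D' : ℤ) := by
        have h4 : 1 ≤ 4 * D := by omega
        rw [Nat.cast_sub h4]; push_cast; rw [hDe]; push_cast; ring
      rw [e1, Int.add_mul_emod_self_right]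
    rw [hbD', jacobiSym.at_neg_one hD'odd, ZMod.χ₄_eq_neg_one_pow (Nat.odd_iff.mp hD'odd), ← pow_add]
    have hb2 : (4 * D - 1) / 2 = 2 * D - 1 := by omega
    have hexp : D' / 2 * ((4 * D - 1) / 2) + D' / 2 = 2 * (D' / 2 * D) := by
      rw [hb2]
      have h2D : 2 * D - 1 + 1 = 2 * D := by omega
      calc D' / 2 * (2 * D - 1) + D' / 2 = D' / 2 * (2 * D - 1 + 1) := by rw [Nat.mul_succ]
        _ = 2 * (D' / 2 * D) := by rw [h2D]; ring
    rw [hexp, pow_mul, neg_one_sq, one_pow]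
  rw [hsplit, h2, hD', one_mul]

/-- **`J(−D | 4D − 1) = −1` for every `D ≥ 1`**: `J(−D | b) = χ₄(b)·J(D | b)` and `b = 4D − 1 ≡ 3 (mod 4)`.
[cite: IrelandRosen1990, Prop. 5.2.2] -/
theorem jacobiSym_neg_natCast_four_mul_sub_one {D : ℕ} (hD : D ≠ 0) : J(-(D : ℤ) | 4 * D - 1) = -1 := by
  have hb_odd : _root_.Odd (4 * D - 1) := ⟨2 * D - 1, by omega⟩
  rw [jacobiSym.neg _ hb_odd, jacobiSym_natCast_four_mul_sub_one hD, mul_one,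
    ZMod.χ₄_nat_three_mod_four (by omega)]

variable {p : ℕ} [hp : Fact p.Prime]

/-- **THE KRONECKER CHARACTER OF AN IMAGINARY QUADRATIC FIELD IS ODD.** For `K` imaginary quadratic and any `ℚ_p`-valued
`ε_K` mod `|d_K|` with `IsKroneckerCharacterOf K ε_K` (primitive; `ε_K(ℓ) = ±1` by the splitting of `ℓ ∤ d_K`): `ε_K(−1) = −1`.
(A prime `ℓ ≡ −1 (mod 4|d_K|)` is inert in `K` since `J(d_K | ℓ) = J(−|d_K| | 4|d_K| − 1) = −1`.) This is the Dirichlet shadow of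
«complex conjugation restricts non-trivially to `K`», needed for the parities of the four lifts in the six-term table.
[cite: Cox2013, §1.C Lemma 1.14 and (1.18)] [cite: KrizLi2019, §2 (p. 12, «ε_K the quadratic character associated with K»)] -/
theorem odd_of_isKroneckerCharacterOf (K : Type) [Field K] [NumberField K] (hK : IsImaginaryQuadratic K)
    {εK : DirichletCharacter ℚ_[p] (NumberField.discr K).natAbs} (hε : IsKroneckerCharacterOf K εK) : εK.Odd := by
  have hdneg : NumberField.discr K < 0 := IsImaginaryQuadratic.discr_neg hK
  have hD0 : (NumberField.discr K).natAbs ≠ 0 := Int.natAbs_ne_zero.mpr hdneg.ne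
  have hdD : NumberField.discr K = -((NumberField.discr K).natAbs : ℤ) := by
    rw [Int.ofNat_natAbs_of_nonpos hdneg.le, neg_neg]
  haveI : NeZero (4 * (NumberField.discr K).natAbs) := ⟨by omega⟩
  haveI : NeZero (NumberField.discr K).natAbs := ⟨hD0⟩
  -- a prime `ℓ ≡ −1 (mod 4D)` not dividing `2D`
  obtain ⟨ℓ, hℓ, hℓN, hℓu⟩ := EisensteinPair.exists_prime_eq_not_dvd (M := 4 * (NumberField.discr K).natAbs) (-1)
    (N := 2 * (NumberField.discr K).natAbs) (by omega)
  rw [Units.val_neg, Units.val_one] at hℓu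
  have hℓ2 : ℓ ≠ 2 := by rintro rfl; exact hℓN (dvd_mul_right 2 _)
  have hℓD : ¬ ℓ ∣ (NumberField.discr K).natAbs := fun h => hℓN (dvd_mul_of_dvd_right h 2)
  have hℓd : ¬ ((ℓ : ℤ) ∣ NumberField.discr K) := by
    rw [hdD, dvd_neg]; exact fun h => hℓD (Int.natCast_dvd_natCast.mp h)
  have hℓodd : _root_.Odd ℓ := hℓ.odd_of_ne_two hℓ2
  -- `ℓ % 4D = 4D − 1`
  have hcast4 : ((4 * (NumberField.discr K).natAbs - 1 : ℕ) : ZMod (4 * (NumberField.discr K).natAbs)) = -1 := by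
    rw [Nat.cast_sub (by omega : 1 ≤ 4 * (NumberField.discr K).natAbs), Nat.cast_one, ZMod.natCast_self, zero_sub]
  have hℓmod : ℓ % (4 * (NumberField.discr K).natAbs) = 4 * (NumberField.discr K).natAbs - 1 := by
    have h1 : (ℓ : ZMod (4 * (NumberField.discr K).natAbs)) =
        ((4 * (NumberField.discr K).natAbs - 1 : ℕ) : ZMod (4 * (NumberField.discr K).natAbs)) := by rw [hℓu, hcast4]
    rw [(ZMod.natCast_eq_natCast_iff' _ _ _).mp h1, Nat.mod_eq_of_lt (by omega)]
  -- `J(d | ℓ) = −1`, so `ℓ` is inert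
  have hJ : jacobiSym (NumberField.discr K) ℓ = -1 := by
    rw [jacobiSym.mod_right _ hℓodd, hℓmod]
    have e : J(NumberField.discr K | 4 * (NumberField.discr K).natAbs - 1) =
        J(-((NumberField.discr K).natAbs : ℤ) | 4 * (NumberField.discr K).natAbs - 1) :=
      congrArg (fun x : ℤ => J(x | 4 * (NumberField.discr K).natAbs - 1)) hdD
    rw [e]
    exact jacobiSym_neg_natCast_four_mul_sub_one hD0
  have hval := hε.2 ℓ hℓ hℓd
  have hns : ¬ ((Ideal.span {(ℓ : ℤ)}).primesOver (NumberField.RingOfIntegers K)).ncard = 2 := by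
    rw [Literature.NumberTheory.QuadraticFields.Quadratic.ncard_primesOver_eq_two_iff_jacobiSym hK.1 hℓ hℓ2, hJ]
    decide
  rw [if_neg hns] at hval
  -- `ε_K(−1) = ε_K(ℓ)`
  have hcastD : ((ℓ : ℕ) : ZMod (NumberField.discr K).natAbs) = -1 := by
    have h := congrArg (ZMod.castHom (dvd_mul_left (NumberField.discr K).natAbs 4) (ZMod (NumberField.discr K).natAbs)) hℓu
    rwa [map_natCast, map_neg, map_one] at h
  change εK (-1) = -1
  rw [← hcastD]
  exact hval

end Summit.BirchSwinnertonDyer.BirchSwinnertonDyer.Theorems.PrintCFram.BernoulliUnits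

end
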